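import Summits.NavierStokesRegularity.TurbBounds.ShearSpecPieces
import Summits.NavierStokesRegularity.TurbBounds.PieceAssembly
import Summits.NavierStokesRegularity.TurbBounds.Certs.S1000.Scalars
import Summits.NavierStokesRegularity.TurbBounds.Certs.S1000.EvalPieces9p1
import Summits.NavierStokesRegularity.TurbBounds.Certs.S1000.EvalPieces9p2
import Summits.NavierStokesRegularity.TurbBounds.Certs.S1000.EvalPieces9p3
import Summits.NavierStokesRegularity.TurbBounds.Certs.S1000.EvalPieces9p4
import Summits.NavierStokesRegularity.TurbBounds.Certs.S1000.EvalPieces9p5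
import Summits.NavierStokesRegularity.TurbBounds.Certs.S1000.SpecPieces9c1
import HarnessLib

/-!
# Row S1000 — mode 9 (part 6/6: Qphi18, Qphi19, Qphi20): the literal evaluator pieces ARE the SPEC 2.8 rule (generator C, kernel)

Container `C1p-fw16-Gx2-Gr1000-P20-N16-j110919` (rbcert.json sha256 15211248adbb023f…; piece dump `blocks_A.rbsdp-blocks0.json.gz` sha256 7e6f3737c61f1cab…), family fw16_shear_2d,
`Γx = 2`, `P = 20`, mode `m = 9`, truncation `N_m = 24`, `dim = 2(N+P+3) = 94`. For each piece X ∈ {Q0, QT, Qφ⁽⁰⁾…Qφ⁽20⁾} of rbsdp SPEC 2.8 the theorem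
`X_9_spec : densify 94 X_9_js X_9_vs = <ShearSpecPieces rule at (N, P, m, Γx, π_lo, π_hi)>` holds by `decide +kernel`: the literal sparse rows of the
landed `EvalPieces9*` files (generator A dump, A/B-agreed) coincide entry for entry with the rule of `TurbBounds/ShearSpecPieces.lean` — a third,
independent transcription of SPEC §1–§2 evaluated in the kernel. With the landed `EvalBlock9.eval_rule` (`B009.A = den • (Q0 + Σ φ̂_p Qφ⁽ᵖ⁾ + T·QT)`)
this closes the algebraic part of SPEC 2.8 for this mode in the kernel: `Cn = den · Q_m(φ̂, T)` with `Q_m` COMPUTED FROM THE FORMULAS. Not in the kernel: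
that the formulas are the Legendre–Galerkin matrices of FW16 (4.13)–(4.15) (bridge, v2), the tail lemma at function level, the cited reduction.
pub-turb-shear gen 6 (generator lean-t12/specpieces/gen_specpieces.py). HONEST FRAMING: rigorous bounds for the stated PDE and boundary conditions; no claim about physical turbulence beyond the bound.
-/

set_option linter.style.longLine false
set_option maxRecDepth 100000

namespace Summit.NavierStokesRegularity.TurbBounds.Certs.S1000.SpecPieces.M9

open Summit.NavierStokesRegularity.TurbBounds.ShearSpecPieces Summit.NavierStokesRegularity.TurbBounds.PieceAssembly Summit.NavierStokesRegularity.TurbBounds.Certs.S1000.Eval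

set_option maxHeartbeats 0 in
/-- **`Qφ⁽18⁾` piece = SPEC rule** (`D = D_9`, `E⁽18⁾ = D0cᵀK⁽18⁾D1`). -/
theorem Qphi18_9_spec : densify 94 Qphi18_9_js Qphi18_9_vs = qphiPiece N P (Dm S1000.Scalars.Gx S1000.Scalars.piLo 9) 18 := by decide +kernel

set_option maxHeartbeats 0 in
/-- **`Qφ⁽19⁾` piece = SPEC rule** (`D = D_9`, `E⁽19⁾ = D0cᵀK⁽19⁾D1`). -/
theorem Qphi19_9_spec : densify 94 Qphi19_9_js Qphi19_9_vs = qphiPiece N P (Dm S1000.Scalars.Gx S1000.Scalars.piLo 9) 19 := by decide +kernel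

set_option maxHeartbeats 0 in
/-- **`Qφ⁽20⁾` piece = SPEC rule** (`D = D_9`, `E⁽20⁾ = D0cᵀK⁽20⁾D1`). -/
theorem Qphi20_9_spec : densify 94 Qphi20_9_js Qphi20_9_vs = qphiPiece N P (Dm S1000.Scalars.Gx S1000.Scalars.piLo 9) 20 := by decide +kernel

end Summit.NavierStokesRegularity.TurbBounds.Certs.S1000.SpecPieces.M9
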